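import Literature.AlgebraicGeometry.Motives.HodgeStructureHodgeGroupCenterFinite
import Literature.AlgebraicGeometry.Motives.HodgeStructureLefschetzGroupCenterFiniteIff
import Literature.AlgebraicGeometry.Motives.HodgeStructureLefschetzGroupCenterBlocks
import Literature.AlgebraicGeometry.Motives.HodgeStructureCentralizerSimpleFactors
import HarnessLib

/-!
# THE CENTRE OF `S(A)(ℚ)` FOR `End⁰(A)` SIMPLE (ONE ISOGENY CLASS) AND SIMPLE FACTOR BY SIMPLE FACTOR: `Z = {±1}` OF ORDER `2`
# (FIRST KIND) OR INFINITE (SECOND KIND); `#Z(S(H)(ℚ)) ∈ {0, 2^t}`; «`†` IS OF THE FIRST KIND IFF IT IS ON EVERY SIMPLE FACTOR»;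
# `#Z(Hg) ∣ 2` (Milne 1999 §1 p. 645 `S₀ = U_{C₀}`, §2 «we may suppose that `A` is simple», Summary p. 652; Moonen–Zarhin 1998 Lemma (1))

[topic AlgebraicGeometry/Motives]

Layer `Literature/AlgebraicGeometry/Motives`, lane `lit-hodgefound` (Track 2 foundations library; prover seat
`lit-hodgefound-p02`, generation 55, self-proposed row g55-#3). THEOREMS ONLY: no definition, no named fact (net debt `0`),
no instance, no notation.  Milne §2 (p. 645): «We wish to calculate `C(A)` and `S(A)` […]. After Propositions 1.1 and 1.5 it
suffices to do this in the case that `A` is simple»; p. 645 L1–L6: `C₀(A)` is «a product of fields», `†` «preserves each factor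
[…] and acts on it as complex conjugation», `S₀(A)(R) = {γ ∈ C₀ ⊗ R | γ†γ = 1}`; Summary p. 652: for a simple `A` the group
`S(A)` is semisimple (types I–III) — finite centre — or not (type IV).  For a polarized `ℚ`-Hodge structure `(H, ψ)` with
`E_φ = End_{ℚ-HS}(V)` SIMPLE (one isotypy class = one canonical block; `C₀ = Z(E_φ)` a FIELD) this file computes the centre of
`S(H)(ℚ) = ψ.lefschetzGroup` WITHOUT A CHART of the centre (the tree's g54-#5∕#9 field-centre forms take a ring isomorphism
`K ≃+* Z(E_φ)` with a number field `K`):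
(i) `†` trivial on `Z(E_φ)` (first kind) ⟹ `Z(S(H)(ℚ)) = {±1}` exactly and `#Z(S(H)(ℚ)) = 2` (`V ≠ 0`); conversely `#Z = 2`
forces the first kind; otherwise (second kind) `Z(S(H)(ℚ))` is infinite, `#Z = 0` as `Nat.card`;
(ii) SIMPLE FACTOR BY SIMPLE FACTOR: every canonical block `S` of an arbitrary polarized `H` has `E_φ(S)` simple, so
`#Z(S(S, ψ|_S)(ℚ)) ∈ {0, 2}`, `= 2` iff `†_S` is of the first kind on `Z(E_φ(S))`; with g55-#2's `#Z(S(H)(ℚ)) = Π_S #Z(S(S)(ℚ))`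
this gives `#Z(S(H)(ℚ)) ∈ {0, 2^t}` (`t` = number of canonical blocks) and the purely ring-theoretic corollary «`†` IS OF THE
FIRST KIND ON `Z(E_φ)` IFF `†_S` IS OF THE FIRST KIND ON `Z(E_φ(S))` FOR EVERY SIMPLE FACTOR `S`» (proved through the centres of
the Lefschetz groups: both sides say that the corresponding centre is finite, g54-#9, and finiteness is block-wise, g55-#2);
(iii) ONE CANONICAL BLOCK ⟺ `E_φ` SIMPLE (`V ≠ 0`), and then `#Z(Hg(H)(ℚ)) ∣ 2`, `Z(Hg(H)(ℚ)) ⊆ {±1}` (first kind).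

## The sources, verbatim

* J. S. Milne, *Lefschetz classes on abelian varieties*, Duke Math. J. 96 (1999) 639–675 [Milne1999LefschetzClasses] (held
  `paper:doi-10-1215-s0012-7094-99-09620-5`, folios 7, 14): p. 645 L1–L6 "`C₀(A)` […] is a product of fields, each of which is
  either a CM-field or `ℚ`. Every Rosati involution `†` preserves each factor of `C₀(A)` and acts on it as complex conjugation.
  […] `S₀(A)(R) = {γ ∈ C₀(A) ⊗_ℚ R | γ†γ = 1}`"; p. 645 L8–L14 (Prop. 1.7: «Both `C₀(A)` and `C_ℓ(A)` satisfy the statement of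
  Proposition 1.1, and so we may suppose that `A` is simple»); p. 645 L30–L33 "After Propositions 1.1 and 1.5 it suffices to
  do this in the case that `A` is simple"; §2 Summary p. 652 (table: I `Sp` semisimple; II `Sp` semisimple; III `O` semisimple;
  IV `GL` not semisimple).
* B. J. J. Moonen, Yu. G. Zarhin, *Weil classes on abelian varieties*, J. reine angew. Math. 496 (1998) 83–92
  [MoonenZarhin1998WeilClasses] (held `paper:arxiv-alg-geom_9612017`, chunk p0002 L121–L127): «Lemma. (1) The center of
  `G_div(X)` is the group `U_{K_B}` […]. For `X` of type 4 with either `d ≥ 2` or `m ≥ 2` this is a connected torus of rank `e₀`;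
  in all other cases it is finite.»
* H. Lange, *Abelian Varieties over the Complex Numbers* (2023) [Lange2023AbelianVarietiesComplex], §2.4.4 Cor. 2.4.26 (simple
  factors), §2.6.2 Lemma 2.6.4 ∕ 2.6.6 (first ∕ second kind on the centre).

Nearest tree results, BY NAME: g54-#5 `Polarization.mem_center_lefschetzGroup_iff_of_isTotallyReal` (chart form of (i)), g54-#8
`Polarization.natCard_center_lefschetzGroup_eq_two_pow`, g54-#9 `Polarization.finite_center_lefschetzGroup_iff` ∕
`infinite_center_lefschetzGroup_iff`, g54-#11 `Polarization.natCard_center_hodgeGroup_dvd_two_pow`, g54-#3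
`isSimpleRing_centralizer_endAlg_iff_natCard_minimal_stable_eq_one`, g54-#1 `isSimpleRing_centralizer_endAlg_iff`, g55-#2
`Polarization.natCard_center_lefschetzGroup_eq_prod_minimal_stable` ∕ `finite_center_lefschetzGroup_iff_forall_minimal_stable`.

## Dictionary and what is proved (namespace `Literature.AlgebraicGeometry.Motives.HodgeStructure`)

`S(H)(ℚ) = ψ.lefschetzGroup`, `Hg(H)(ℚ) = H.hodgeGroup`, `Z(·) = Subgroup.center`, `Z(E_φ) = Subalgebra.center ℚ H.endAlg`, `†` =
`ψ.adjoint`; "first kind" = `∀ z ∈ Z(E_φ), z† = z`; a canonical block = a minimal non-zero `E_φ`-stable `S : SubHodgeStructure H`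
(the tree's predicate, verbatim); `#` = `Nat.card` (`0` for infinite types); §4 under the tree's standing `[HodgeTensorFacts]`.

* §1 **`natCard_minimal_stable_eq_one_iff_isSimpleRing_endAlg`** (one canonical block iff `E_φ` simple, `V ≠ 0`),
  **`isSimpleRing_endAlg_of_minimal_stable`** (`E_φ(S)` is simple for every canonical block `S`).
* §2 `E_φ` SIMPLE: **`Polarization.mem_center_lefschetzGroup_iff_of_isSimpleRing`** (first kind: central iff `↑γ = ±1`),
  **`Polarization.natCard_center_lefschetzGroup_eq_two_of_isSimpleRing`** (`#Z = 2`),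
  **`Polarization.natCard_center_lefschetzGroup_eq_two_iff_of_isSimpleRing`** (`#Z = 2` iff first kind),
  **`Polarization.natCard_center_lefschetzGroup_eq_zero_iff`** (`#Z = 0` iff second kind; any `H`).
* §3 ANY `H`: **`Polarization.natCard_center_lefschetzGroup_eq_zero_or_eq_two_pow`** (`#Z ∈ {0, 2^t}`),
  **`Polarization.natCard_center_lefschetzGroup_restrict_eq_zero_or_eq_two`** (per canonical block: `#Z_S ∈ {0, 2}`),
  **`Polarization.natCard_center_lefschetzGroup_restrict_eq_two_iff`** (`#Z_S = 2` iff `†_S` first kind on `Z(E_φ(S))`),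
  **`Polarization.natCard_center_lefschetzGroup_ne_zero_iff_forall_minimal_stable`**,
  **`Polarization.forall_adjoint_center_eq_self_iff_forall_minimal_stable`** (first kind iff first kind on every simple factor).
* §4 `Hg`: **`Polarization.natCard_center_hodgeGroup_dvd_two_of_isSimpleRing`**,
  **`Polarization.coe_eq_one_or_eq_neg_one_of_mem_center_hodgeGroup_of_isSimpleRing`**.
-/

noncomputable section

namespace Literature.AlgebraicGeometry.Motives

namespace HodgeStructure

universe u

variable {V : Type u} [AddCommGroup V] [Module ℚ V] [Module.Finite ℚ V] {n : ℤ} {H : HodgeStructure V n}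

/-! ## §1 One canonical block iff `E_φ` is simple; the block algebras `E_φ(S)` are simple -/

/-- **ONE CANONICAL BLOCK ⟺ `E_φ` SIMPLE** (polarizable `H`, `V ≠ 0`): the number of minimal non-zero `E_φ`-stable sub-Hodge
structures is `1` iff `E_φ` is a simple ring — «`A` is isogenous to a power of a simple abelian variety iff `End⁰(A)` is simple»
(g54-#3 `isSimpleRing_centralizer_endAlg_iff_natCard_minimal_stable_eq_one` with g54-#1 `isSimpleRing_centralizer_endAlg_iff`).
[cite: Milne1999LefschetzClasses, §1 Prop. 1.1 and §2 p. 645 L30–L33] [cite: Lange2023AbelianVarietiesComplex, §2.4.4 Cor. 2.4.26 (p. 124)] -/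
theorem natCard_minimal_stable_eq_one_iff_isSimpleRing_endAlg [Nontrivial V] (hH : H.IsPolarizable) :
    Nat.card {S : SubHodgeStructure H // (∀ a ∈ H.endAlg, ∀ v ∈ S.toSubmodule, a v ∈ S.toSubmodule) ∧ S.toSubmodule ≠ ⊥ ∧
        ∀ S' : SubHodgeStructure H, (∀ a ∈ H.endAlg, ∀ v ∈ S'.toSubmodule, a v ∈ S'.toSubmodule) →
          S'.toSubmodule ≤ S.toSubmodule → S'.toSubmodule = ⊥ ∨ S'.toSubmodule = S.toSubmodule} = 1 ↔
      IsSimpleRing H.endAlg := by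
  rw [← isSimpleRing_centralizer_endAlg_iff_natCard_minimal_stable_eq_one hH, isSimpleRing_centralizer_endAlg_iff H hH]

/-- **THE BLOCK ALGEBRA `E_φ(S)` OF A CANONICAL BLOCK IS SIMPLE** (polarizable `H`): a minimal non-zero `E_φ`-stable sub-Hodge
structure `S` is an isotypic component `W_k = ⨆_{c i = k} Tᵢ` of a labelled irreducible decomposition (the tree's
`existsUnique_iSup'_fiber_eq_of_minimal_stable`), whose endomorphism algebra is a matrix algebra over a division ring
(`isSimpleRing_endAlg_iSup'_fiber`) — «`End⁰(A_i^{n_i}) = M_{n_i}(End⁰(A_i))`». [cite: Lange2023AbelianVarietiesComplex, §2.4.4 Cor. 2.4.26 (p. 124)]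
[cite: Milne1999LefschetzClasses, §2 p. 645 L30–L33] -/
theorem isSimpleRing_endAlg_of_minimal_stable (hH : H.IsPolarizable) {S : SubHodgeStructure H}
    (hS : (∀ a ∈ H.endAlg, ∀ v ∈ S.toSubmodule, a v ∈ S.toSubmodule) ∧ S.toSubmodule ≠ ⊥ ∧
      ∀ S' : SubHodgeStructure H, (∀ a ∈ H.endAlg, ∀ v ∈ S'.toSubmodule, a v ∈ S'.toSubmodule) →
        S'.toSubmodule ≤ S.toSubmodule → S'.toSubmodule = ⊥ ∨ S'.toSubmodule = S.toSubmodule) :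
    IsSimpleRing S.toHodgeStructure.endAlg := by
  classical
  obtain ⟨s, _, κ, c, hT, hirr, hc, hκ⟩ := exists_isInternal_isIrreducible_labelling H hH
  have hirr' : ∀ x : s, (x : SubHodgeStructure H).toHodgeStructure.IsIrreducible := fun x => hirr x x.2
  obtain ⟨k, hk, -⟩ :=
    existsUnique_iSup'_fiber_eq_of_minimal_stable (fun S : s => (S : SubHodgeStructure H)) hT hc hκ hirr' hS
  subst hk
  exact isSimpleRing_endAlg_iSup'_fiber (fun S : s => (S : SubHodgeStructure H)) hT hc hκ hirr' k

/-! ## §2 `E_φ` simple: `Z(S(H)(ℚ)) = {±1}` of order `2` (first kind), or infinite (second kind) -/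

omit [Module.Finite ℚ V] in
/-- In a commutative ring which is a field, `y² = 1 ⟹ y = ±1`. [folklore] -/
private theorem eq_one_or_eq_neg_one_of_mul_self_eq_one₅₅₃ {R : Type*} [CommRing R] (hR : IsField R) {y : R}
    (hy : y * y = 1) : y = 1 ∨ y = -1 := by
  by_cases h : y - 1 = 0
  · exact Or.inl (sub_eq_zero.1 h)
  · obtain ⟨w, hw⟩ := hR.mul_inv_cancel h
    refine Or.inr (eq_neg_of_add_eq_zero_left ?_)
    calc y + 1 = (y - 1) * w * (y + 1) := by rw [hw, one_mul]
      _ = w * ((y - 1) * (y + 1)) := by ring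
      _ = 0 := by rw [show (y - 1) * (y + 1) = 0 by linear_combination hy, mul_zero]

/-- **`E_φ` SIMPLE AND `†` OF THE FIRST KIND ⟹ `Z(S(H)(ℚ)) = {±1}`, CHART-FREE**: if `E_φ` is simple (one isotypy class; its
centre `C₀` is a FIELD) and `†` is trivial on `C₀`, then `γ ∈ S(H)(ℚ)` is central iff `↑γ = 1` or `↑γ = -1` — a central `γ` is
`↑z`, `z ∈ C₀` with `z† z = z² = 1` (g54-#5), and in a field `z = ±1`; `±1 ∈ E_φ` are central (g54-#4).  Milne's `S₀(A)(ℚ) =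
{x ∈ C₀ | x² = 1} = {±1}` for a simple `A` of type I–III. [cite: Milne1999LefschetzClasses, §1 p. 645 L1–L6 and §2 p. 646 L10–L16, Summary p. 652]
[cite: Lange2023AbelianVarietiesComplex, §2.6.2 Lemma 2.6.4] -/
theorem Polarization.mem_center_lefschetzGroup_iff_of_isSimpleRing (ψ : Polarization H) (hs : IsSimpleRing H.endAlg)
    (hfix : ∀ z : H.endAlg, z ∈ Subalgebra.center ℚ H.endAlg → ψ.adjoint (z : Module.End ℚ V) = z) (γ : ψ.lefschetzGroup) :
    γ ∈ Subgroup.center ψ.lefschetzGroup ↔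
      ((γ : V ≃ₗ[ℚ] V) : Module.End ℚ V) = 1 ∨ ((γ : V ≃ₗ[ℚ] V) : Module.End ℚ V) = -1 := by
  constructor
  · intro hγ
    obtain ⟨z, hzc, hzγ⟩ := (ψ.mem_center_lefschetzGroup_iff_exists_mem_center γ).1 hγ
    have hzc' : z ∈ Subring.center H.endAlg := Subring.mem_center_iff.2 (Subalgebra.mem_center_iff.1 hzc)
    have hzz : (⟨z, hzc'⟩ : Subring.center H.endAlg) * ⟨z, hzc'⟩ = 1 := by
      apply Subtype.ext
      apply Subtype.ext
      show ((z * z : H.endAlg) : Module.End ℚ V) = ((1 : H.endAlg) : Module.End ℚ V)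
      rw [Subalgebra.coe_mul, Subalgebra.coe_one, hzγ]
      exact ψ.coe_mul_coe_eq_one_of_mem_center_lefschetzGroup hfix hγ
    rw [← hzγ]
    rcases eq_one_or_eq_neg_one_of_mul_self_eq_one₅₅₃ (isField_subringCenter_endAlg_of_isSimpleRing H hs) hzz with h | h
    · left
      have h' := congrArg (fun x : Subring.center H.endAlg => ((x : H.endAlg) : Module.End ℚ V)) h
      simpa only [OneMemClass.coe_one] using h'
    · right
      have h' := congrArg (fun x : Subring.center H.endAlg => ((x : H.endAlg) : Module.End ℚ V)) h
      simpa only [NegMemClass.coe_neg, OneMemClass.coe_one] using h'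
  · intro h
    rw [ψ.mem_center_lefschetzGroup_iff]
    rcases h with h | h
    · rw [h]; exact one_mem _
    · rw [h]; exact neg_mem (one_mem _)

/-- **`E_φ` SIMPLE, FIRST KIND, `V ≠ 0` ⟹ `#Z(S(H)(ℚ)) = 2`** — one canonical block (§1), so g54-#8's `#Z = 2^t` reads `2¹`;
equivalently `Z(S(H)(ℚ)) = {1, -1}` with `1 ≠ -1`.  «Semisimple: Yes» for the simple types I–III, with the centre `μ₂`.
[cite: Milne1999LefschetzClasses, §1 p. 645 L1–L6 and §2 Summary p. 652] [cite: MoonenZarhin1998WeilClasses, §1 Lemma (1)] -/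
theorem Polarization.natCard_center_lefschetzGroup_eq_two_of_isSimpleRing [Nontrivial V] (ψ : Polarization H)
    (hs : IsSimpleRing H.endAlg)
    (hfix : ∀ z : H.endAlg, z ∈ Subalgebra.center ℚ H.endAlg → ψ.adjoint (z : Module.End ℚ V) = z) :
    Nat.card (Subgroup.center ψ.lefschetzGroup) = 2 := by
  rw [ψ.natCard_center_lefschetzGroup_eq_two_pow hfix, (natCard_minimal_stable_eq_one_iff_isSimpleRing_endAlg ⟨ψ⟩).2 hs,
    pow_one]

/-- **`E_φ` SIMPLE, `V ≠ 0`: `#Z(S(H)(ℚ)) = 2` IFF `†` IS OF THE FIRST KIND** (`⟸` above; `⟹`: `#Z ≠ 0` means the centre is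
finite, and a finite centre forces the first kind, g54-#9 `Polarization.finite_center_lefschetzGroup_iff`).
[cite: Milne1999LefschetzClasses, §2 Summary p. 652] [cite: MoonenZarhin1998WeilClasses, §1 Lemma (1)] [cite: Lange2023AbelianVarietiesComplex, §2.6.2 Lemma 2.6.4 and 2.6.6] -/
theorem Polarization.natCard_center_lefschetzGroup_eq_two_iff_of_isSimpleRing [Nontrivial V] (ψ : Polarization H)
    (hs : IsSimpleRing H.endAlg) :
    Nat.card (Subgroup.center ψ.lefschetzGroup) = 2 ↔
      ∀ z : H.endAlg, z ∈ Subalgebra.center ℚ H.endAlg → ψ.adjoint (z : Module.End ℚ V) = z := by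
  refine ⟨fun h => ?_, ψ.natCard_center_lefschetzGroup_eq_two_of_isSimpleRing hs⟩
  haveI : Finite (Subgroup.center ψ.lefschetzGroup) := Nat.finite_of_card_ne_zero (by rw [h]; exact two_ne_zero)
  exact ψ.finite_center_lefschetzGroup_iff.1 inferInstance

/-- **`#Z(S(H)(ℚ)) = 0` (AS `Nat.card`) IFF `†` IS OF THE SECOND KIND** — for every polarized `H`: the centre is non-empty, so
`#Z = 0` iff it is infinite, iff `†` moves some central Hodge endomorphism (g54-#9 `Polarization.infinite_center_lefschetzGroup_iff`);
for `E_φ` simple this is the type-IV alternative «not semisimple». [cite: Milne1999LefschetzClasses, §2 Summary p. 652]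
[cite: MoonenZarhin1998WeilClasses, §1 Lemma (1)] [cite: Lange2023AbelianVarietiesComplex, §2.6.2 Lemma 2.6.6] -/
theorem Polarization.natCard_center_lefschetzGroup_eq_zero_iff (ψ : Polarization H) :
    Nat.card (Subgroup.center ψ.lefschetzGroup) = 0 ↔
      ∃ z : H.endAlg, z ∈ Subalgebra.center ℚ H.endAlg ∧ ψ.adjoint (z : Module.End ℚ V) ≠ z := by
  rw [Nat.card_eq_zero, ← ψ.infinite_center_lefschetzGroup_iff]
  exact ⟨fun h => h.resolve_left (not_isEmpty_of_nonempty _), Or.inr⟩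

/-! ## §3 Any `H`: `#Z(S(H)(ℚ)) ∈ {0, 2^t}`, simple factor by simple factor -/

/-- **`#Z(S(H)(ℚ)) ∈ {0, 2^t}`** (`t` = number of canonical blocks) for every polarized `H`: `2^t` when `†` is of the first kind
(g54-#8), `0` = infinite otherwise (g54-#9) — Milne's Summary ∕ Moonen–Zarhin's Lemma (1) as one counting statement.
[cite: Milne1999LefschetzClasses, §1 p. 645 L1–L14 and §2 Summary p. 652] [cite: MoonenZarhin1998WeilClasses, §1 Lemma (1)] -/
theorem Polarization.natCard_center_lefschetzGroup_eq_zero_or_eq_two_pow (ψ : Polarization H) :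
    Nat.card (Subgroup.center ψ.lefschetzGroup) = 0 ∨
      Nat.card (Subgroup.center ψ.lefschetzGroup) =
        2 ^ Nat.card {S : SubHodgeStructure H // (∀ a ∈ H.endAlg, ∀ v ∈ S.toSubmodule, a v ∈ S.toSubmodule) ∧
          S.toSubmodule ≠ ⊥ ∧ ∀ S' : SubHodgeStructure H, (∀ a ∈ H.endAlg, ∀ v ∈ S'.toSubmodule, a v ∈ S'.toSubmodule) →
            S'.toSubmodule ≤ S.toSubmodule → S'.toSubmodule = ⊥ ∨ S'.toSubmodule = S.toSubmodule} := by
  by_cases hfix : ∀ z : H.endAlg, z ∈ Subalgebra.center ℚ H.endAlg → ψ.adjoint (z : Module.End ℚ V) = z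
  · exact Or.inr (ψ.natCard_center_lefschetzGroup_eq_two_pow hfix)
  · left
    push Not at hfix
    exact ψ.natCard_center_lefschetzGroup_eq_zero_iff.2 hfix

/-- **PER SIMPLE FACTOR: `#Z(S(S, ψ|_S)(ℚ)) ∈ {0, 2}` FOR EVERY CANONICAL BLOCK `S`** — `E_φ(S)` is simple (§1) and `S ≠ 0`, so §2
applies to `(S, ψ|_S)`: order `2` for a block of type I–III, infinite (`0`) for a block of type IV.
[cite: Milne1999LefschetzClasses, §2 p. 645 L30–L33 («it suffices to do this in the case that A is simple») and Summary p. 652]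
[cite: MoonenZarhin1998WeilClasses, §1 Lemma (1)] -/
theorem Polarization.natCard_center_lefschetzGroup_restrict_eq_zero_or_eq_two (ψ : Polarization H) {S : SubHodgeStructure H}
    (hS : (∀ a ∈ H.endAlg, ∀ v ∈ S.toSubmodule, a v ∈ S.toSubmodule) ∧ S.toSubmodule ≠ ⊥ ∧
      ∀ S' : SubHodgeStructure H, (∀ a ∈ H.endAlg, ∀ v ∈ S'.toSubmodule, a v ∈ S'.toSubmodule) →
        S'.toSubmodule ≤ S.toSubmodule → S'.toSubmodule = ⊥ ∨ S'.toSubmodule = S.toSubmodule) :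
    Nat.card (Subgroup.center (ψ.restrict S).lefschetzGroup) = 0 ∨
      Nat.card (Subgroup.center (ψ.restrict S).lefschetzGroup) = 2 := by
  haveI : Nontrivial S.toSubmodule := Submodule.nontrivial_iff_ne_bot.2 hS.2.1
  by_cases hfix : ∀ z : S.toHodgeStructure.endAlg, z ∈ Subalgebra.center ℚ S.toHodgeStructure.endAlg →
      (ψ.restrict S).adjoint (z : Module.End ℚ S.toSubmodule) = z
  · exact Or.inr ((ψ.restrict S).natCard_center_lefschetzGroup_eq_two_of_isSimpleRing
      (isSimpleRing_endAlg_of_minimal_stable ⟨ψ⟩ hS) hfix)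
  · left
    push Not at hfix
    exact (ψ.restrict S).natCard_center_lefschetzGroup_eq_zero_iff.2 hfix

/-- **PER SIMPLE FACTOR: `#Z(S(S, ψ|_S)(ℚ)) = 2` IFF `†_S` IS OF THE FIRST KIND ON `Z(E_φ(S))`** (canonical block `S`; §2 for the
simple `E_φ(S)`). [cite: Milne1999LefschetzClasses, §2 p. 645 L30–L33 and Summary p. 652] [cite: Lange2023AbelianVarietiesComplex, §2.6.2 Lemma 2.6.4 and 2.6.6] -/
theorem Polarization.natCard_center_lefschetzGroup_restrict_eq_two_iff (ψ : Polarization H) {S : SubHodgeStructure H}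
    (hS : (∀ a ∈ H.endAlg, ∀ v ∈ S.toSubmodule, a v ∈ S.toSubmodule) ∧ S.toSubmodule ≠ ⊥ ∧
      ∀ S' : SubHodgeStructure H, (∀ a ∈ H.endAlg, ∀ v ∈ S'.toSubmodule, a v ∈ S'.toSubmodule) →
        S'.toSubmodule ≤ S.toSubmodule → S'.toSubmodule = ⊥ ∨ S'.toSubmodule = S.toSubmodule) :
    Nat.card (Subgroup.center (ψ.restrict S).lefschetzGroup) = 2 ↔
      ∀ z : S.toHodgeStructure.endAlg, z ∈ Subalgebra.center ℚ S.toHodgeStructure.endAlg →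
        (ψ.restrict S).adjoint (z : Module.End ℚ S.toSubmodule) = z := by
  haveI : Nontrivial S.toSubmodule := Submodule.nontrivial_iff_ne_bot.2 hS.2.1
  exact (ψ.restrict S).natCard_center_lefschetzGroup_eq_two_iff_of_isSimpleRing (isSimpleRing_endAlg_of_minimal_stable ⟨ψ⟩ hS)

/-- **`#Z(S(H)(ℚ)) ≠ 0` (THE CENTRE IS FINITE) IFF `†_S` IS OF THE FIRST KIND ON EVERY SIMPLE FACTOR** — `#Z(S(H)(ℚ)) =
Π_S #Z(S(S)(ℚ))` over the canonical blocks (g55-#2) with each factor `0` or `2`. [cite: Milne1999LefschetzClasses, §1 Prop. 1.5, §2 p. 645 L30–L33 and Summary p. 652]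
[cite: MoonenZarhin1998WeilClasses, §1 Lemma (1)] -/
theorem Polarization.natCard_center_lefschetzGroup_ne_zero_iff_forall_minimal_stable (ψ : Polarization H) :
    Nat.card (Subgroup.center ψ.lefschetzGroup) ≠ 0 ↔
      ∀ S : SubHodgeStructure H, ((∀ a ∈ H.endAlg, ∀ v ∈ S.toSubmodule, a v ∈ S.toSubmodule) ∧ S.toSubmodule ≠ ⊥ ∧
        ∀ S' : SubHodgeStructure H, (∀ a ∈ H.endAlg, ∀ v ∈ S'.toSubmodule, a v ∈ S'.toSubmodule) →
          S'.toSubmodule ≤ S.toSubmodule → S'.toSubmodule = ⊥ ∨ S'.toSubmodule = S.toSubmodule) →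
        ∀ z : S.toHodgeStructure.endAlg, z ∈ Subalgebra.center ℚ S.toHodgeStructure.endAlg →
          (ψ.restrict S).adjoint (z : Module.End ℚ S.toSubmodule) = z := by
  rw [ψ.natCard_center_lefschetzGroup_eq_prod_minimal_stable, Finset.prod_ne_zero_iff]
  refine ⟨fun h S hS => ?_, fun h S hSm => ?_⟩
  · have hS' : S ∈ ψ.finite_setOf_minimal_stable.toFinset := by rw [Set.Finite.mem_toFinset]; exact hS
    rcases ψ.natCard_center_lefschetzGroup_restrict_eq_zero_or_eq_two hS with h0 | h2
    · exact absurd h0 (h S hS')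
    · exact (ψ.natCard_center_lefschetzGroup_restrict_eq_two_iff hS).1 h2
  · have hS : (∀ a ∈ H.endAlg, ∀ v ∈ S.toSubmodule, a v ∈ S.toSubmodule) ∧ S.toSubmodule ≠ ⊥ ∧
        ∀ S' : SubHodgeStructure H, (∀ a ∈ H.endAlg, ∀ v ∈ S'.toSubmodule, a v ∈ S'.toSubmodule) →
          S'.toSubmodule ≤ S.toSubmodule → S'.toSubmodule = ⊥ ∨ S'.toSubmodule = S.toSubmodule := by
      rwa [Set.Finite.mem_toFinset] at hSm
    rw [(ψ.natCard_center_lefschetzGroup_restrict_eq_two_iff hS).2 (h S hS)]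
    exact two_ne_zero

/-- **`†` IS OF THE FIRST KIND ON `Z(E_φ)` IFF `†_S` IS OF THE FIRST KIND ON `Z(E_φ(S))` FOR EVERY SIMPLE FACTOR `S`** («Every
Rosati involution `†` preserves each factor of `C₀(A)`»: triviality on `C₀ = Π_S Z(E_φ(S))` is read factor by factor) — proved
through the Lefschetz groups: the left side says `Z(S(H)(ℚ))` is finite (g54-#9), the right side says every `Z(S(S)(ℚ))` is
finite (g54-#9 for the simple `E_φ(S)`), and finiteness of the centre is block-wise (g55-#2
`Polarization.finite_center_lefschetzGroup_iff_forall_minimal_stable`). [cite: Milne1999LefschetzClasses, §1 p. 645 L1–L6 and Prop. 1.5]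
[cite: Lange2023AbelianVarietiesComplex, §2.4.4 Cor. 2.4.26 and §2.6.2 Lemma 2.6.4] -/
theorem Polarization.forall_adjoint_center_eq_self_iff_forall_minimal_stable (ψ : Polarization H) :
    (∀ z : H.endAlg, z ∈ Subalgebra.center ℚ H.endAlg → ψ.adjoint (z : Module.End ℚ V) = z) ↔
      ∀ S : SubHodgeStructure H, ((∀ a ∈ H.endAlg, ∀ v ∈ S.toSubmodule, a v ∈ S.toSubmodule) ∧ S.toSubmodule ≠ ⊥ ∧
        ∀ S' : SubHodgeStructure H, (∀ a ∈ H.endAlg, ∀ v ∈ S'.toSubmodule, a v ∈ S'.toSubmodule) →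
          S'.toSubmodule ≤ S.toSubmodule → S'.toSubmodule = ⊥ ∨ S'.toSubmodule = S.toSubmodule) →
        ∀ z : S.toHodgeStructure.endAlg, z ∈ Subalgebra.center ℚ S.toHodgeStructure.endAlg →
          (ψ.restrict S).adjoint (z : Module.End ℚ S.toSubmodule) = z := by
  rw [← ψ.finite_center_lefschetzGroup_iff, ψ.finite_center_lefschetzGroup_iff_forall_minimal_stable]
  refine forall_congr' fun S => forall_congr' fun hS => ?_
  haveI : Module.Finite ℚ S.toSubmodule := inferInstance
  exact (ψ.restrict S).finite_center_lefschetzGroup_iff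

/-! ## §4 The Hodge group of an isotypic `H`: `#Z(Hg(H)(ℚ)) ∣ 2`, `Z(Hg(H)(ℚ)) ⊆ {±1}` -/

section HodgeGroup

variable [HodgeTensorFacts.{u, u}]

/-- **`E_φ` SIMPLE, FIRST KIND, `V ≠ 0` ⟹ `#Z(Hg(H)(ℚ)) ∣ 2`** — `Z(Hg(H)(ℚ)) ↪ Z(S(H)(ℚ))` of order `2` (g54-#11
`Polarization.natCard_center_hodgeGroup_dvd_two_pow` with one canonical block): «if `X` has no factors of type IV then `Hdg(X)`
is semi-simple», sharpened for an isotypic `X`. [cite: MoonenZarhin1998WeilClasses, §1 («Z(Hdg) ⊂ U_E»; Lemma (1))]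
[cite: Milne1999LefschetzClasses, §1 p. 645 L1–L14 and §2 Summary p. 652] -/
theorem Polarization.natCard_center_hodgeGroup_dvd_two_of_isSimpleRing [Nontrivial V] (ψ : Polarization H)
    (hs : IsSimpleRing H.endAlg)
    (hfix : ∀ z : H.endAlg, z ∈ Subalgebra.center ℚ H.endAlg → ψ.adjoint (z : Module.End ℚ V) = z) :
    Nat.card (Subgroup.center H.hodgeGroup) ∣ 2 := by
  have h := ψ.natCard_center_hodgeGroup_dvd_two_pow hfix
  rwa [(natCard_minimal_stable_eq_one_iff_isSimpleRing_endAlg ⟨ψ⟩).2 hs, pow_one] at h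

/-- **`E_φ` SIMPLE, FIRST KIND ⟹ `Z(Hg(H)(ℚ)) ⊆ {±1}`, CHART-FREE** (a central element of `Hg(H)(ℚ)` is central in `S(H)(ℚ)`,
g54-#7 `Polarization.inclusion_mem_center_lefschetzGroup`, where §2 applies; the tree's
`Polarization.coe_eq_one_or_eq_neg_one_of_mem_center_hodgeGroup` is the chart form with a totally real number field `K ≅ C₀`).
[cite: MoonenZarhin1998WeilClasses, §1 («Z(Hdg) ⊂ U_E»)] [cite: Milne1999LefschetzClasses, §2 p. 646 L10–L16 and Summary p. 652] -/
theorem Polarization.coe_eq_one_or_eq_neg_one_of_mem_center_hodgeGroup_of_isSimpleRing (ψ : Polarization H)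
    (hs : IsSimpleRing H.endAlg)
    (hfix : ∀ z : H.endAlg, z ∈ Subalgebra.center ℚ H.endAlg → ψ.adjoint (z : Module.End ℚ V) = z)
    {γ : H.hodgeGroup} (hγ : γ ∈ Subgroup.center H.hodgeGroup) :
    ((γ : V ≃ₗ[ℚ] V) : Module.End ℚ V) = 1 ∨ ((γ : V ≃ₗ[ℚ] V) : Module.End ℚ V) = -1 :=
  (ψ.mem_center_lefschetzGroup_iff_of_isSimpleRing hs hfix (Subgroup.inclusion ψ.hodgeGroup_le_lefschetzGroup γ)).1
    (ψ.inclusion_mem_center_lefschetzGroup hγ)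

end HodgeGroup

end HodgeStructure

end Literature.AlgebraicGeometry.Motives
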